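import Summits.AtomisticToContinuum.Crystallization.Theorems.PhononSlackCertificatesNearFieldConvexityCoarseRegime
import Summits.AtomisticToContinuum.Crystallization.Theorems.NashClassCertificatesNashNearFieldStubChartCoreAssemblyWeak
import Summits.AtomisticToContinuum.Crystallization.Theorems.NashClassCertificatesNashNearFieldStubLabelledPlacement

/-!
# The crux `NearFieldConvexity` in the coarse regime `η ≥ 2/5` — UNCONDITIONAL
(crux `PhononSlackCertificates.NearFieldConvexity`, stmt-AtomisticToContinuum-13958, line `Sketch`, lead c4, skeleton v22)

`stub_coarseRegime` (this line, p164216) proved the crux for every `η ≥ 2/5` GIVEN the chart core; the chart core is now a theorem: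
the twin crux's lead landed `NashClassCertificatesNashNearField.stub_labelledPlacement` (p170130; computable certificate tree
`TwoShellChartCert{Fcc,Hcp}` with soundness) — exactly the text registered on both cruxes — and the twin's assembly
`stub_chartCore_of_labelled_placement` (p161895) turns it into `stub_chartCore`.  Hence, with NO hypothesis:

**for every `δ > 0` and every `η ≥ 2/5` there are `c > 0`, `C` such that for every `δ`-separated configuration and every finite set
`Ω` of `1/20`-good particles, `c·#{i ∈ Ω : B(x i, 2) not η-layered} − C·#∂₄Ω ≤ Σ_{i∈Ω}(e_i − e*)`.**

What remains of the crux (`∀ η > 0`) is the quantitative regime `η < 2/5`: the two registered energy stubs of skeleton v22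
(`stub_thresholdSqPaid`, perturbative, and `stub_roughSitesPaid`, non-perturbative).  [folklore]
-/

noncomputable section

open Literature.MathematicalPhysics.StatisticalMechanics Literature.Geometry.DiscreteGeometry

namespace Summit.AtomisticToContinuum.Crystallization.Theorems.PhononSlackNearFieldConvexity

/-- **Registered milestone `stub_nearFieldConvexityCoarse`: the crux `NearFieldConvexity` for every `η ≥ 2/5`, unconditionally.**
[folklore] -/
theorem stub_nearFieldConvexityCoarse : ∀ δ : ℝ, 0 < δ → ∀ η : ℝ, 2 / 5 ≤ η → ∃ c : ℝ, 0 < c ∧ ∃ C : ℝ, ∀ (N : ℕ) (x : Fin N → EuclideanSpace ℝ (Fin 3)), (∀ i j : Fin N, i ≠ j → δ ≤ dist (x i) (x j)) → ∀ Ω : Finset (Fin N), (∀ i ∈ Ω, IsTwoShellGood (1 / 20) (47 / 50) 1 x i) → c * (Nat.card {i : Fin N // i ∈ Ω ∧ ¬ (∃ (A : EuclideanSpace ℝ (Fin 3) →ₗᵢ[ℝ] EuclideanSpace ℝ (Fin 3)) (t : EuclideanSpace ℝ (Fin 3)) (a : ℝ) (s : ℤ → ℤ) (z : ℤ → ℝ),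 47 / 50 ≤ a ∧ a ≤ 1 ∧ IsHaggSeq s ∧ (∀ m : ℤ, 39 / 50 * a ≤ z (m + 1) - z m ∧ z (m + 1) - z m ≤ 17 / 20 * a) ∧ (fun S : Set (EuclideanSpace ℝ (Fin 3)) => (∀ j : Fin N, dist (x j) (x i) ≤ 2 → ∃ p ∈ S, dist (x j + t) p ≤ η) ∧ (∀ p ∈ S, dist p (x i + t) ≤ 2 → ∃ j : Fin N, dist (x j + t) p ≤ η)) {p | ∃ m i j : ℤ, p = A (((i : ℝ) • triangularVec₁ a) + ((j : ℝ) • triangularVec₂ a) + ((haggLabel s m : ℝ) • barlowOffset a) + (z m • layerNormal 1))})} : ℝ) - C * (Nat.card {i : Fin N // i ∈ Ω ∧ ∃ j : Fin N, j ∉ Ω ∧ dist (x j) (x i) ≤ 4} : ℝ) ≤ ∑ i ∈ Ω, ((1 / 2 : ℝ) * (∑ j ∈ Finset.univ.erase i, lennardJones (dist (x i) (x j))) - (⨅ Q : PeriodicConfiguration 3, Q.energyPerParticle lennardJones)) :=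
  stub_coarseRegime
    (Summit.AtomisticToContinuum.Crystallization.Theorems.NashClassCertificatesNashNearField.stub_chartCore_of_labelled_placement
      Summit.AtomisticToContinuum.Crystallization.Theorems.NashClassCertificatesNashNearField.stub_labelledPlacement)

end Summit.AtomisticToContinuum.Crystallization.Theorems.PhononSlackNearFieldConvexity
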